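import Literature.NumberTheory.Sieve.HeathBrownCubicFLSequencesA
import Literature.NumberTheory.Sieve.HeathBrownCubicUpperBoundTools
import Mathlib.NumberTheory.LSeries.Dirichlet
import Mathlib.NumberTheory.ZetaValues
import HarnessLib

/-!
# Heath-Brown's Lemma 3.5, III: the remainders of `𝒜` — coprime pairs, and the level from Lemma 3.2

Third file of the proof of the named fact `HeathBrown2001_lemma_3_5`
(`HeathBrownCubicSieveDecomposition`; D. R. Heath-Brown, *Primes represented by `x³ + 2y³`*, Acta
Math. 186 (2001), Lemma 3.5, §6), continuing `HeathBrownCubicFLSequencesA`. There the remainders of the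
Fundamental Lemma for the rational sequences `𝒜_q` were bounded by the Type I errors
`|#𝒜^(K)_R − (6η²X²/π²)ρ₂(R)/N(R)|` of Lemma 3.2 (`abs_remainder_seqA_le`); summed over the chains and
the sieve moduli these run over all ideals `R` of square-free norm `≤ X^{1+τ}D ≤ X^{3/2}` (p. 35:
"`≪ ∑_{r ≤ X^{3/2}} μ(r)²τ(r)² |#𝒜_r − (6η²X²/π²)ρ₀(r)/r| ≪ X^{7/4}(log X)^c` by Lemma 2.1"). This file
PROVES the two inputs of that estimate:

* `exists_abs_countA_one_sub_sizeA_le` — **the number of coprime pairs in the box**: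
  `|#𝒜^(K) − 6η²X²/π²| ≤ 40 X (1 + log X)` for `X ≥ 2`, `0 ≤ η ≤ 1` (the term `R = 1`, which the
  range `Q < N(R) ≤ 2Q`, `Q ≥ 1`, of Lemma 3.2 omits), by Möbius inversion over `gcd(x, y)`
  (`card_coprime_pairs_eq_sum_moebius`, the `d`-sum of (5.3) at `R = 1`), `⌊b/e⌋ − ⌊a/e⌋ = L/e + O(1)`,
  and `∑ μ(n)/n² = 6/π²` with the tail `∑_{n>M} 1/n² ≤ 1/M` (`tsum_moebiusSq`,
  `abs_sum_moebiusSq_sub_le`; Mathlib's `L(ζ,2)L(μ,2) = 1` and `ζ(2) = π²/6`);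
* `level_of_typeI_A` — **from `HeathBrown2001_typeI_A` (Lemma 3.2, a named fact of
  `HeathBrownCubicSieveSetup`, here a HYPOTHESIS): there are `θ < 2` (`θ = 15/8`) and `C, X₀` with
  `∑_{N(R) square-free ≤ X^{3/2}} |#𝒜^(K)_R − (6η²X²/π²)ρ₂(R)/N(R)| ≤ C X^θ`** for `X ≥ X₀`,
  `exp(−(log X)^{1/3}) ≤ η ≤ 1`, by Lemma 3.2 with `A = 1` on the `≤ 4 log X` dyadic blocks `(2^j, 2^{j+1}]`
  (each `≪ X^{7/4}(log X)^c`), plus the coprime-pair count at `R = 1`.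

The second statement is spelled out (rather than named) so that the proof of Lemma 3.5 can take it
as an explicit hypothesis, to be fed either by Lemma 3.2 (this theorem) or by any direct proof of a
level `X^{3/2}` with a power saving.

## References

* D. R. Heath-Brown, *Primes represented by `x³ + 2y³`*, Acta Math. 186 (2001), 1–84: Lemma 3.2 (p. 11),
  (5.3)–(5.4) (pp. 30–31), §6 p. 35. [cite: HeathBrownActa2001, §6 p. 35]

## Mathlib / tree search

Mathlib: `ArithmeticFunction.LSeries_zeta_mul_Lseries_moebius`, `ArithmeticFunction.LSeries_zeta_eq_riemannZeta`,
`riemannZeta_two`, `ArithmeticFunction.moebius_mul_coe_zeta`, `ArithmeticFunction.coe_mul_zeta_apply`,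
`Nat.Ioc_filter_dvd_card_eq_div`, `sum_Ioc_inv_sq_le_sub`, `Real.tsum_le_of_sum_range_le`,
`Summable.sum_add_tsum_nat_add`, `norm_tsum_le_tsum_norm`, `Complex.ofReal_tsum`,
`isLittleO_log_rpow_rpow_atTop`, `Ideal.absNorm_eq_one_iff`, `Nat.pow_log_le_self`. Tree:
`HeathBrownCubicFLSequencesA` (`sizeA`), `HeathBrownCubicSieveSetup` (`boxPairs`, `countA`, `APairs_one`,
`rho₂`, `idealDivisorCount`, `HeathBrown2001_typeI_A`), `HeathBrownCubicUpperBoundTools`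
(`sum_inv_le_one_add_log`, `dyadIdx`, `pow_dyadIdx_lt`, `le_pow_dyadIdx_succ`, `sum_union_le_add`).
-/

noncomputable section

open Polynomial NumberField Finset Filter Topology
open scoped ArithmeticFunction.Moebius ArithmeticFunction.omega

namespace Literature.NumberTheory.Sieve.CubicSieve

open LFunctions.CubeRootTwoField CubicPrimes
open Literature.NumberTheory.LFunctions (idealNormCount)

/-! ### `∑ μ(n)/n² = 6/π²` with the tail estimate -/

/-- `μ(n)/n²`. [folklore] -/
def moebiusSq (n : ℕ) : ℝ := (μ n : ℝ) / (n : ℝ) ^ 2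

/-- `|μ(n)/n²| ≤ 1/n²`. [folklore] -/
theorem abs_moebiusSq_le (n : ℕ) : |moebiusSq n| ≤ 1 / (n : ℝ) ^ 2 := by
  rw [moebiusSq, abs_div, abs_of_nonneg (by positivity : (0 : ℝ) ≤ (n : ℝ) ^ 2)]
  refine div_le_div_of_nonneg_right ?_ (by positivity)
  exact_mod_cast ArithmeticFunction.abs_moebius_le_one

/-- `∑ μ(n)/n²` converges absolutely. [folklore] -/
theorem summable_moebiusSq : Summable moebiusSq :=
  Summable.of_norm_bounded (g := fun n : ℕ => 1 / (n : ℝ) ^ 2)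
    (Real.summable_one_div_nat_pow.mpr one_lt_two) fun n => by
      rw [Real.norm_eq_abs]; exact abs_moebiusSq_le n

/-- **`∑_{n ≥ 1} μ(n)/n² = 6/π² = 1/ζ(2)`** (Mathlib: `L(ζ, 2)·L(μ, 2) = 1`, `ζ(2) = π²/6`). [folklore] -/
theorem tsum_moebiusSq : ∑' n, moebiusSq n = 6 / Real.pi ^ 2 := by
  have hs : 1 < (2 : ℂ).re := by norm_num
  have hzeta : LSeries (fun n => (ArithmeticFunction.zeta n : ℂ)) 2 = (Real.pi : ℂ) ^ 2 / 6 := by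
    rw [ArithmeticFunction.LSeries_zeta_eq_riemannZeta hs, riemannZeta_two]
  have hmu : LSeries (fun n => (μ n : ℂ)) 2 = 6 / (Real.pi : ℂ) ^ 2 := by
    have h := ArithmeticFunction.LSeries_zeta_mul_Lseries_moebius hs
    rw [hzeta] at h
    have hpi : (Real.pi : ℂ) ^ 2 ≠ 0 := pow_ne_zero 2 (by exact_mod_cast Real.pi_ne_zero)
    field_simp at h
    field_simp
    linear_combination h
  have hterm : ∀ n : ℕ, (moebiusSq n : ℂ) = LSeries.term (fun n => (μ n : ℂ)) 2 n := by
    intro n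
    rcases eq_or_ne n 0 with rfl | hn
    · simp [moebiusSq, LSeries.term_zero]
    · rw [LSeries.term_of_ne_zero hn, moebiusSq, Complex.cpow_two]
      push_cast
      rfl
  have h : ((∑' n, moebiusSq n : ℝ) : ℂ) = 6 / (Real.pi : ℂ) ^ 2 := by
    rw [Complex.ofReal_tsum, ← hmu, LSeries]
    exact tsum_congr hterm
  exact_mod_cast h

/-- The tail `∑_{n > M} 1/n² ≤ 1/M` (`M ≥ 1`). [folklore] -/
theorem tsum_inv_sq_tail_le {M : ℕ} (hM : 1 ≤ M) :
    ∑' n, 1 / ((n + (M + 1) : ℕ) : ℝ) ^ 2 ≤ 1 / (M : ℝ) := by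
  refine Real.tsum_le_of_sum_range_le (fun n => by positivity) fun N => ?_
  have hshift : ∑ i ∈ range N, 1 / (((i + (M + 1) : ℕ) : ℝ)) ^ 2 =
      ∑ j ∈ Ioc M (M + N), ((j : ℝ) ^ 2)⁻¹ := by
    rw [← Finset.Ico_add_one_add_one_eq_Ioc, Finset.sum_Ico_eq_sum_range]
    simp only [show M + N + 1 - (M + 1) = N by omega, one_div]
    refine sum_congr rfl fun i _ => ?_
    congr 2
    push_cast
    ring
  rw [hshift]
  rcases Nat.eq_zero_or_pos N with rfl | hN
  · simp
  calc ∑ j ∈ Ioc M (M + N), ((j : ℝ) ^ 2)⁻¹ ≤ (M : ℝ)⁻¹ - ((M + N : ℕ) : ℝ)⁻¹ :=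
        sum_Ioc_inv_sq_le_sub (by omega) (Nat.le_add_right M N)
    _ ≤ 1 / (M : ℝ) := by
        rw [one_div]
        have : (0 : ℝ) ≤ ((M + N : ℕ) : ℝ)⁻¹ := by positivity
        linarith

/-- **`|∑_{n ≤ M} μ(n)/n² − 6/π²| ≤ 1/M`** (`M ≥ 1`). [folklore] -/
theorem abs_sum_moebiusSq_sub_le {M : ℕ} (hM : 1 ≤ M) :
    |∑ n ∈ Icc 1 M, moebiusSq n - 6 / Real.pi ^ 2| ≤ 1 / (M : ℝ) := by
  have hsplit := (summable_moebiusSq.sum_add_tsum_nat_add (M + 1))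
  rw [tsum_moebiusSq] at hsplit
  have hrange : ∑ n ∈ range (M + 1), moebiusSq n = ∑ n ∈ Icc 1 M, moebiusSq n := by
    rw [range_eq_Ico, sum_eq_sum_Ico_succ_bot (Nat.succ_pos M), Nat.succ_eq_add_one,
      Finset.Ico_add_one_right_eq_Icc, zero_add]
    simp [moebiusSq]
  rw [hrange] at hsplit
  have hsum_tail : Summable (fun n => moebiusSq (n + (M + 1))) :=
    summable_moebiusSq.comp_injective (add_left_injective (M + 1))
  have hsq_tail : Summable (fun n : ℕ => 1 / ((n + (M + 1) : ℕ) : ℝ) ^ 2) :=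
    (Real.summable_one_div_nat_pow.mpr one_lt_two).comp_injective (add_left_injective (M + 1))
  have htail : |∑' n, moebiusSq (n + (M + 1))| ≤ 1 / (M : ℝ) := by
    calc |∑' n, moebiusSq (n + (M + 1))| = ‖∑' n, moebiusSq (n + (M + 1))‖ := (Real.norm_eq_abs _).symm
      _ ≤ ∑' n, ‖moebiusSq (n + (M + 1))‖ := norm_tsum_le_tsum_norm hsum_tail.norm
      _ ≤ ∑' n, 1 / ((n + (M + 1) : ℕ) : ℝ) ^ 2 :=
          Summable.tsum_le_tsum (fun n => by rw [Real.norm_eq_abs]; exact abs_moebiusSq_le _)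
            hsum_tail.norm hsq_tail
      _ ≤ 1 / (M : ℝ) := tsum_inv_sq_tail_le hM
  calc |∑ n ∈ Icc 1 M, moebiusSq n - 6 / Real.pi ^ 2| = |-(∑' n, moebiusSq (n + (M + 1)))| := by
        congr 1; linarith
    _ = |∑' n, moebiusSq (n + (M + 1))| := abs_neg _
    _ ≤ 1 / (M : ℝ) := htail

/-! ### Counting coprime pairs in a square by Möbius inversion -/

/-- `∑_{e ∣ n} μ(e) = [n = 1]` (as integers). [folklore] -/
theorem sum_divisors_moebius_eq (n : ℕ) : ∑ e ∈ n.divisors, (μ e : ℤ) = if n = 1 then 1 else 0 := by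
  have h := congrArg (fun f : ArithmeticFunction ℤ => f n) ArithmeticFunction.moebius_mul_coe_zeta
  simp only [ArithmeticFunction.coe_mul_zeta_apply, ArithmeticFunction.one_apply] at h
  exact h

/-- The multiples of `e` in `(a, b]`: `⌊b/e⌋ − ⌊a/e⌋` of them (`a ≤ b`). [folklore] -/
theorem card_Ioc_filter_dvd (e : ℕ) {a b : ℕ} (hab : a ≤ b) :
    #{x ∈ Ioc a b | e ∣ x} = b / e - a / e := by
  have hset : ({x ∈ Ioc a b | e ∣ x} : Finset ℕ) = {x ∈ Ioc 0 b | e ∣ x} \ {x ∈ Ioc 0 a | e ∣ x} := by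
    ext x
    simp only [mem_filter, mem_Ioc, Finset.mem_sdiff]
    omega
  have hsub : ({x ∈ Ioc 0 a | e ∣ x} : Finset ℕ) ⊆ {x ∈ Ioc 0 b | e ∣ x} := by
    intro x hx
    simp only [mem_filter, mem_Ioc] at hx ⊢
    omega
  rw [hset, card_sdiff_of_subset hsub, Nat.Ioc_filter_dvd_card_eq_div, Nat.Ioc_filter_dvd_card_eq_div]

/-- **Möbius inversion for coprime pairs in a square**: for `a ≤ b`,
`#{(x, y) ∈ (a, b]² : gcd(x, y) = 1} = ∑_{1 ≤ e ≤ b} μ(e) (⌊b/e⌋ − ⌊a/e⌋)²` (the case `R = 1`, `d`-sum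
of (5.3): "`#𝒜^(K)_R = ∑_d μ(d) #{x, y : d ∣ x, y, …}`"). [cite: HeathBrownActa2001, §5 (5.3)] -/
theorem card_coprime_pairs_eq_sum_moebius {a b : ℕ} (hab : a ≤ b) :
    (#{xy ∈ Ioc a b ×ˢ Ioc a b | Nat.Coprime xy.1 xy.2} : ℤ) =
      ∑ e ∈ Icc 1 b, (μ e : ℤ) * ((b / e - a / e : ℕ) : ℤ) ^ 2 := by
  classical
  -- right side as a double sum over the pairs
  have hR : ∀ e ∈ Icc 1 b, (μ e : ℤ) * ((b / e - a / e : ℕ) : ℤ) ^ 2 =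
      ∑ xy ∈ Ioc a b ×ˢ Ioc a b, if e ∣ xy.1 ∧ e ∣ xy.2 then (μ e : ℤ) else 0 := by
    intro e _
    have hcard : #((Ioc a b ×ˢ Ioc a b).filter fun xy : ℕ × ℕ => e ∣ xy.1 ∧ e ∣ xy.2) =
        (b / e - a / e) * (b / e - a / e) := by
      rw [Finset.filter_product, card_product, card_Ioc_filter_dvd e hab]
    rw [sq, ← Nat.cast_mul, ← hcard, natCast_card_filter, mul_sum]
    exact sum_congr rfl fun xy _ => by split_ifs <;> simp
  rw [sum_congr rfl hR, sum_comm, natCast_card_filter]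
  refine sum_congr rfl fun xy hxy => ?_
  rw [mem_product, mem_Ioc, mem_Ioc] at hxy
  obtain ⟨⟨hx1, hxb⟩, hy1, -⟩ := hxy
  have hx0 : xy.1 ≠ 0 := by omega
  have hg0 : Nat.gcd xy.1 xy.2 ≠ 0 := Nat.gcd_ne_zero_left hx0
  have hset : ∀ e ∈ Icc 1 b, (e ∣ xy.1 ∧ e ∣ xy.2 ↔ e ∈ (Nat.gcd xy.1 xy.2).divisors) := by
    intro e _
    rw [Nat.mem_divisors, Nat.dvd_gcd_iff]
    exact ⟨fun h => ⟨h, hg0⟩, fun h => h.1⟩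
  rw [sum_congr rfl fun e he => if_congr (hset e he) rfl rfl, ← Finset.sum_filter]
  have hfilter : (Icc 1 b).filter (fun e => e ∈ (Nat.gcd xy.1 xy.2).divisors) = (Nat.gcd xy.1 xy.2).divisors := by
    ext e
    simp only [mem_filter, mem_Icc, Nat.mem_divisors, and_iff_right_iff_imp, and_imp]
    intro he _
    exact ⟨Nat.pos_of_dvd_of_pos he (Nat.pos_of_ne_zero hg0),
      (Nat.le_of_dvd (Nat.pos_of_ne_zero hg0) he).trans ((Nat.gcd_le_left _ (by omega)).trans hxb)⟩
  rw [hfilter, sum_divisors_moebius_eq]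

/-- `𝒜^(K)` as the coprime pairs of the integer square `(⌊X⌋, ⌊X(1+η)⌋]²` (`X ≥ 0`, `η ≥ −1`).
[folklore] -/
theorem boxPairs_eq_filter_Ioc {X η : ℝ} (hX : 0 ≤ X) (hη : 0 ≤ 1 + η) :
    boxPairs X η = (Ioc ⌊X⌋₊ ⌊X * (1 + η)⌋₊ ×ˢ Ioc ⌊X⌋₊ ⌊X * (1 + η)⌋₊).filter
      fun xy => Nat.Coprime xy.1 xy.2 := by
  have hXη : 0 ≤ X * (1 + η) := mul_nonneg hX hη
  ext ⟨x, y⟩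
  rw [mem_boxPairs_iff, mem_filter, mem_product, mem_Ioc, mem_Ioc, Nat.floor_lt hX, Nat.floor_lt hX,
    Nat.le_floor_iff hXη, Nat.le_floor_iff hXη]
  tauto

/-- **The number of coprime pairs in the box is `6η²X²/π² + O(X log X)`**: there is an absolute `C`
with `|#𝒜^(K) − 6η²X²/π²| ≤ C X (1 + log X)` for `X ≥ 2`, `0 ≤ η ≤ 1` — the remainder `R_1` of the
Fundamental Lemma for `𝒜` (the case `R = 1`, excluded from the range `Q < N(R) ≤ 2Q`, `Q ≥ 1`, of
Lemma 3.2). [cite: HeathBrownActa2001, §5 (5.3)–(5.4)] -/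
theorem exists_abs_countA_one_sub_sizeA_le :
    ∃ C : ℝ, 0 < C ∧ ∀ X η : ℝ, 2 ≤ X → 0 ≤ η → η ≤ 1 →
      |(countA X η 1 : ℝ) - sizeA X η| ≤ C * X * (1 + Real.log X) := by
  refine ⟨40, by norm_num, fun X η hX hη0 hη1 => ?_⟩
  have hX0 : 0 ≤ X := by linarith
  set a : ℕ := ⌊X⌋₊ with ha
  set b : ℕ := ⌊X * (1 + η)⌋₊ with hb
  have hab : a ≤ b := Nat.floor_le_floor (by nlinarith)
  have hb1 : 1 ≤ b := Nat.le_floor (by push_cast; nlinarith)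
  have hbr : (1 : ℝ) ≤ b := by exact_mod_cast hb1
  have hb2X : (b : ℝ) ≤ 2 * X := (Nat.floor_le (by nlinarith)).trans (by nlinarith)
  -- `#𝒜^(K) = ∑ μ(e) n_e²`
  have hcount : (countA X η 1 : ℝ) = ∑ e ∈ Icc 1 b, (μ e : ℝ) * ((b / e - a / e : ℕ) : ℝ) ^ 2 := by
    rw [countA, APairs_one, boxPairs_eq_filter_Ioc hX0 (by linarith)]
    have h := card_coprime_pairs_eq_sum_moebius hab
    have h' := congrArg (Int.cast : ℤ → ℝ) h
    push_cast at h'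
    rw [← ha, ← hb]
    exact_mod_cast h'
  -- `n_e = L/e + O(1)` with `L = b - a`
  set L : ℝ := (b : ℝ) - a with hL
  have hL0 : 0 ≤ L := by rw [hL]; exact sub_nonneg.mpr (by exact_mod_cast hab)
  have hLb : L ≤ b := by rw [hL]; linarith [(Nat.cast_nonneg a : (0 : ℝ) ≤ a)]
  have hne : ∀ e ∈ Icc 1 b, |((b / e - a / e : ℕ) : ℝ) - L / e| ≤ 1 := by
    intro e he
    have he_pos : 0 < e := (mem_Icc.mp he).1
    have he1 : (1 : ℝ) ≤ e := by exact_mod_cast he_pos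
    have he0 : (0 : ℝ) < e := by linarith
    have hdiv_le : a / e ≤ b / e := Nat.div_le_div_right hab
    rw [Nat.cast_sub hdiv_le]
    have h1 : ((b / e : ℕ) : ℝ) ≤ b / e := Nat.cast_div_le
    have h2 : (b : ℝ) / e - 1 < ((b / e : ℕ) : ℝ) := by
      have hlt : (b : ℝ) < ((b / e : ℕ) : ℝ) * e + e := by exact_mod_cast Nat.lt_div_mul_add he_pos
      rw [div_sub_one he0.ne', div_lt_iff₀ he0]
      linarith
    have h3 : ((a / e : ℕ) : ℝ) ≤ a / e := Nat.cast_div_le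
    have h4 : (a : ℝ) / e - 1 < ((a / e : ℕ) : ℝ) := by
      have hlt : (a : ℝ) < ((a / e : ℕ) : ℝ) * e + e := by exact_mod_cast Nat.lt_div_mul_add he_pos
      rw [div_sub_one he0.ne', div_lt_iff₀ he0]
      linarith
    rw [hL, sub_div, abs_le]
    constructor <;> linarith
  -- termwise: `|μ(e) n_e² − μ(e) L²/e²| ≤ 2L/e + 1`
  have hterm : ∀ e ∈ Icc 1 b, |(μ e : ℝ) * ((b / e - a / e : ℕ) : ℝ) ^ 2 - L ^ 2 * moebiusSq e| ≤
      2 * L * (e : ℝ)⁻¹ + 1 := by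
    intro e he
    have he1 : (1 : ℝ) ≤ e := by exact_mod_cast (mem_Icc.mp he).1
    have he0 : (0 : ℝ) < e := by linarith
    set u : ℝ := ((b / e - a / e : ℕ) : ℝ) with hu
    have hu0 : 0 ≤ u := Nat.cast_nonneg _
    have hv0 : 0 ≤ L / e := div_nonneg hL0 he0.le
    have huv := hne e he
    have hμ : |(μ e : ℝ)| ≤ 1 := by exact_mod_cast ArithmeticFunction.abs_moebius_le_one
    have hsq : |u ^ 2 - (L / e) ^ 2| ≤ 2 * L * (e : ℝ)⁻¹ + 1 := by
      rw [sq_sub_sq, abs_mul]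
      have h1 : |u + L / e| ≤ 2 * L / e + 1 := by
        rw [abs_of_nonneg (by positivity), show 2 * L / (e : ℝ) = 2 * (L / e) by ring]
        have := (abs_le.mp huv).2
        linarith
      calc |u + L / e| * |u - L / e| ≤ (2 * L / e + 1) * 1 :=
            mul_le_mul h1 huv (abs_nonneg _) (by positivity)
        _ = 2 * L * (e : ℝ)⁻¹ + 1 := by ring
    calc |(μ e : ℝ) * u ^ 2 - L ^ 2 * moebiusSq e| = |(μ e : ℝ)| * |u ^ 2 - (L / e) ^ 2| := by
          rw [← abs_mul, moebiusSq]; ring_nf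
      _ ≤ 1 * (2 * L * (e : ℝ)⁻¹ + 1) := mul_le_mul hμ hsq (abs_nonneg _) zero_le_one
      _ = 2 * L * (e : ℝ)⁻¹ + 1 := one_mul _
  -- sum of the termwise errors
  have hharm : ∑ e ∈ Icc 1 b, (e : ℝ)⁻¹ ≤ 1 + Real.log b :=
    sum_inv_le_one_add_log hbr _ fun e he => ⟨(mem_Icc.mp he).1, by exact_mod_cast (mem_Icc.mp he).2⟩
  have herr1 : |∑ e ∈ Icc 1 b, ((μ e : ℝ) * ((b / e - a / e : ℕ) : ℝ) ^ 2 - L ^ 2 * moebiusSq e)| ≤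
      2 * L * (1 + Real.log b) + b := by
    refine (abs_sum_le_sum_abs _ _).trans ((sum_le_sum hterm).trans ?_)
    rw [sum_add_distrib, sum_const, Nat.card_Icc, nsmul_eq_mul, ← mul_sum]
    simp only [add_tsub_cancel_right, mul_one]
    nlinarith [mul_le_mul_of_nonneg_left hharm (by positivity : 0 ≤ 2 * L)]
  -- the Möbius series
  have herr2 : |L ^ 2 * ∑ e ∈ Icc 1 b, moebiusSq e - L ^ 2 * (6 / Real.pi ^ 2)| ≤ L ^ 2 / b := by
    rw [← mul_sub, abs_mul, abs_of_nonneg (sq_nonneg L)]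
    calc L ^ 2 * |∑ e ∈ Icc 1 b, moebiusSq e - 6 / Real.pi ^ 2| ≤ L ^ 2 * (1 / b) :=
          mul_le_mul_of_nonneg_left (abs_sum_moebiusSq_sub_le hb1) (sq_nonneg L)
      _ = L ^ 2 / b := by ring
  -- `L = ηX + O(1)`
  have hLη : |L - η * X| ≤ 1 := by
    rw [hL, ha, hb]
    have h1 := Nat.floor_le (mul_nonneg hX0 (by linarith : (0 : ℝ) ≤ 1 + η))
    have h2 := Nat.lt_floor_add_one (X * (1 + η))
    have h3 := Nat.floor_le hX0
    have h4 := Nat.lt_floor_add_one X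
    rw [abs_le]; constructor <;> nlinarith
  have herr3 : |L ^ 2 * (6 / Real.pi ^ 2) - sizeA X η| ≤ 2 * η * X + 1 := by
    rw [sizeA, show 6 * η ^ 2 * X ^ 2 / Real.pi ^ 2 = (η * X) ^ 2 * (6 / Real.pi ^ 2) by ring, ← sub_mul,
      abs_mul, abs_of_nonneg (by positivity : (0 : ℝ) ≤ 6 / Real.pi ^ 2)]
    have hpi : 6 / Real.pi ^ 2 ≤ 1 := by
      rw [div_le_one (by positivity)]
      nlinarith [Real.pi_gt_three]
    have hsq : |L ^ 2 - (η * X) ^ 2| ≤ 2 * η * X + 1 := by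
      rw [sq_sub_sq, abs_mul]
      have hs : |L + η * X| ≤ 2 * η * X + 1 := by
        rw [abs_of_nonneg (by nlinarith)]
        linarith [(abs_le.mp hLη).2]
      calc |L + η * X| * |L - η * X| ≤ (2 * η * X + 1) * 1 :=
            mul_le_mul hs hLη (abs_nonneg _) (by nlinarith)
        _ = 2 * η * X + 1 := mul_one _
    calc |L ^ 2 - (η * X) ^ 2| * (6 / Real.pi ^ 2) ≤ (2 * η * X + 1) * 1 :=
          mul_le_mul hsq hpi (by positivity) (by nlinarith)
      _ = 2 * η * X + 1 := mul_one _
  -- assemble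
  have hlogb : Real.log b ≤ Real.log X + 1 := by
    calc Real.log b ≤ Real.log (2 * X) := Real.log_le_log (by linarith) hb2X
      _ = Real.log 2 + Real.log X := Real.log_mul (by norm_num) (by linarith)
      _ ≤ Real.log X + 1 := by linarith [Real.log_two_lt_d9]
  have hlogX : 0 ≤ Real.log X := Real.log_nonneg (by linarith)
  have hmain : |(countA X η 1 : ℝ) - sizeA X η| ≤
      (2 * L * (1 + Real.log b) + b) + L ^ 2 / b + (2 * η * X + 1) := by
    rw [hcount]
    have e1 := abs_le.mp herr1
    have e2 := abs_le.mp herr2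
    have e3 := abs_le.mp herr3
    rw [sum_sub_distrib, ← mul_sum] at e1
    rw [abs_le]
    constructor <;> linarith [e1.1, e1.2, e2.1, e2.2, e3.1, e3.2]
  refine hmain.trans ?_
  have hL2 : L ^ 2 / b ≤ L := by
    rw [div_le_iff₀ (by linarith), sq]
    exact mul_le_mul_of_nonneg_left hLb hL0
  have hL2X : L ≤ 2 * X := hLb.trans hb2X
  nlinarith [mul_le_mul_of_nonneg_left hlogb (by positivity : 0 ≤ 2 * L),
    mul_nonneg hL0 hlogX, mul_nonneg hX0 hlogX]


/-! ### The level of distribution of `𝒜^(K)` from Lemma 3.2 (dyadic summation) -/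

/-- `∑ over ⋃_{i∈S} t i ≤ ∑_i ∑ over t i` for non-negative summands. [folklore] -/
theorem sum_biUnion_le_sum_sum_of_nonneg {ι β : Type*} [DecidableEq β] (S : Finset ι) (t : ι → Finset β)
    {f : β → ℝ} (hf : ∀ x, 0 ≤ f x) : ∑ x ∈ S.biUnion t, f x ≤ ∑ i ∈ S, ∑ x ∈ t i, f x := by
  classical
  induction S using Finset.induction_on with
  | empty => simp
  | insert a S ha ih =>
    rw [biUnion_insert, sum_insert ha]
    exact (sum_union_le_add _ _ hf).trans (by linarith)

/-- `τ(R) ≥ 1` for `R ≠ 0` (`R` divides itself). [folklore] -/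
theorem one_le_idealDivisorCount' {R : Ideal (𝓞 K)} : 1 ≤ idealDivisorCount R := by
  classical
  rw [idealDivisorCount]
  exact card_pos.mpr ⟨R, mem_filter.mpr ⟨mem_idealsLE.mpr le_rfl, dvd_refl R⟩⟩

/-- The growth comparison behind the choice of exponent `15/8`: for `C₁, C₂ ≥ 0`, `c ≥ 0`,
`C₁ X (1 + log X) + C₂ log X · X^{7/4} ((5/2) log X)^c ≤ X^{15/8}` for all large `X` (any real `c`). [folklore] -/
theorem eventually_level_bound {C₁ C₂ c : ℝ} (hC₁ : 0 ≤ C₁) (hC₂ : 0 ≤ C₂) :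
    ∀ᶠ X : ℝ in atTop, C₁ * X * (1 + Real.log X) +
      C₂ * Real.log X * X ^ (7 / 4 : ℝ) * ((5 / 2) * Real.log X) ^ c ≤ X ^ (15 / 8 : ℝ) := by
  -- `(log X)^{c+1} ≤ ε X^{1/8}` and `log X ≤ ε X^{7/8}` eventually
  have h1 : ∀ᶠ X : ℝ in atTop, ‖Real.log X ^ (c + 1)‖ ≤ (1 / (2 * (C₂ + 1) * (5 / 2) ^ c)) * ‖X ^ (1 / 8 : ℝ)‖ :=
    (isLittleO_log_rpow_rpow_atTop (c + 1) (by norm_num : (0 : ℝ) < 1 / 8)).def (by positivity)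
  have h2 : ∀ᶠ X : ℝ in atTop, ‖Real.log X ^ (1 : ℝ)‖ ≤ (1 / (4 * (C₁ + 1))) * ‖X ^ (7 / 8 : ℝ)‖ :=
    (isLittleO_log_rpow_rpow_atTop 1 (by norm_num : (0 : ℝ) < 7 / 8)).def (by positivity)
  filter_upwards [h1, h2, eventually_ge_atTop (3 : ℝ)] with X hX1 hX2 hX3
  have hX0 : 0 < X := by linarith
  have hlog1 : 1 ≤ Real.log X := by
    rw [← Real.log_exp 1]
    exact Real.log_le_log (Real.exp_pos 1) (by linarith [Real.exp_one_lt_d9])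
  have hlog0 : 0 < Real.log X := by linarith
  rw [Real.norm_eq_abs, Real.norm_eq_abs, abs_of_nonneg (Real.rpow_nonneg hlog0.le _),
    abs_of_nonneg (Real.rpow_nonneg hX0.le _)] at hX1 hX2
  rw [Real.rpow_one] at hX2
  -- first term
  have hA : C₁ * X * (1 + Real.log X) ≤ X ^ (15 / 8 : ℝ) / 2 := by
    have h18 : X * X ^ (7 / 8 : ℝ) = X ^ (15 / 8 : ℝ) := by
      rw [← Real.rpow_one_add' hX0.le (by norm_num)]; norm_num
    calc C₁ * X * (1 + Real.log X) ≤ C₁ * X * (2 * Real.log X) := by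
          apply mul_le_mul_of_nonneg_left (by linarith) (by positivity)
      _ = 2 * C₁ * (X * Real.log X) := by ring
      _ ≤ 2 * C₁ * (X * ((1 / (4 * (C₁ + 1))) * X ^ (7 / 8 : ℝ))) := by
          apply mul_le_mul_of_nonneg_left _ (by positivity)
          exact mul_le_mul_of_nonneg_left hX2 hX0.le
      _ = (C₁ / (2 * (C₁ + 1))) * X ^ (15 / 8 : ℝ) := by rw [← h18]; field_simp; ring
      _ ≤ (1 / 2) * X ^ (15 / 8 : ℝ) := by
          apply mul_le_mul_of_nonneg_right _ (Real.rpow_nonneg hX0.le _)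
          rw [div_le_div_iff₀ (by positivity) (by norm_num)]
          linarith
      _ = X ^ (15 / 8 : ℝ) / 2 := by ring
  -- second term
  have hB : C₂ * Real.log X * X ^ (7 / 4 : ℝ) * ((5 / 2) * Real.log X) ^ c ≤ X ^ (15 / 8 : ℝ) / 2 := by
    have hsplit : ((5 / 2) * Real.log X) ^ c = (5 / 2 : ℝ) ^ c * Real.log X ^ c :=
      Real.mul_rpow (by norm_num) hlog0.le
    have hpow : Real.log X * Real.log X ^ c = Real.log X ^ (c + 1) := by
      rw [Real.rpow_add hlog0, Real.rpow_one, mul_comm]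
    have h18 : X ^ (7 / 4 : ℝ) * X ^ (1 / 8 : ℝ) = X ^ (15 / 8 : ℝ) := by
      rw [← Real.rpow_add hX0]; norm_num
    have h52 : (0 : ℝ) < (5 / 2 : ℝ) ^ c := Real.rpow_pos_of_pos (by norm_num) _
    calc C₂ * Real.log X * X ^ (7 / 4 : ℝ) * ((5 / 2) * Real.log X) ^ c
        = C₂ * (5 / 2 : ℝ) ^ c * X ^ (7 / 4 : ℝ) * Real.log X ^ (c + 1) := by rw [hsplit, ← hpow]; ring
      _ ≤ C₂ * (5 / 2 : ℝ) ^ c * X ^ (7 / 4 : ℝ) * ((1 / (2 * (C₂ + 1) * (5 / 2) ^ c)) * X ^ (1 / 8 : ℝ)) := by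
          apply mul_le_mul_of_nonneg_left hX1 (by positivity)
      _ = (C₂ / (2 * (C₂ + 1))) * X ^ (15 / 8 : ℝ) := by rw [← h18]; field_simp
      _ ≤ (1 / 2) * X ^ (15 / 8 : ℝ) := by
          apply mul_le_mul_of_nonneg_right _ (Real.rpow_nonneg hX0.le _)
          rw [div_le_div_iff₀ (by positivity) (by norm_num)]
          linarith
      _ = X ^ (15 / 8 : ℝ) / 2 := by ring
  linarith

open scoped Classical in
/-- **The level of distribution of `𝒜^(K)` from Lemma 3.2 (with A = 1, summed dyadically, plus the
coprime-pair count at `R = 1`).** If `HeathBrown2001_typeI_A` holds then there are `θ < 2` (here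
`θ = 15/8`) and `C, X₀` with
`∑_{R ∈ 𝒯r, N(R) ≤ X^{3/2}} |#𝒜^(K)_R − (6η²X²/π²)ρ₂(R)/N(R)| ≤ C X^θ` for `X ≥ X₀`,
`exp(−(log X)^{1/3}) ≤ η ≤ 1`: Lemma 3.2 over the `≤ 4 log X` dyadic blocks `(2^j, 2^{j+1}]` covering
`1 < N(R) ≤ X^{3/2}` gives `≪ X^{7/4}(log X)^{c+1}` (p. 35: "the error term … contributes to `T^(n)(𝒜)`
a total `≪ ∑_{r ≤ X^{3/2}} μ(r)²τ(r)²|#𝒜_r − (6η²X²/π²)ρ₀(r)/r| ≪ X^{7/4}(log X)^c` by Lemma 2.1"). This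
is the form of the Type I input consumed by the proof of Lemma 3.5. [cite: HeathBrownActa2001, §6 p. 35] -/
theorem level_of_typeI_A (h : HeathBrown2001_typeI_A) :
    ∃ θ : ℝ, θ < 2 ∧ ∃ C X₀ : ℝ, ∀ X η : ℝ, X₀ ≤ X → Real.exp (-Real.log X ^ (1 / 3 : ℝ)) ≤ η → η ≤ 1 →
      ∑ R ∈ (idealsLE ⌊X ^ (3 / 2 : ℝ)⌋₊).filter (fun R => Squarefree (Ideal.absNorm R)),
        |(countA X η R : ℝ) - sizeA X η * rho₂ R / Ideal.absNorm R| ≤ C * X ^ θ := by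
  obtain ⟨c, C, hC⟩ := h 1 one_pos
  obtain ⟨C₁, hC₁0, hC₁⟩ := exists_abs_countA_one_sub_sizeA_le
  set c' : ℝ := max c 0 with hc'
  set C' : ℝ := max C 0 with hC'
  have hc'0 : 0 ≤ c' := le_max_right _ _
  have hC'0 : 0 ≤ C' := le_max_right _ _
  obtain ⟨X₁, hX₁⟩ := Filter.eventually_atTop.mp
    (eventually_level_bound (c := c') hC₁0.le (by positivity : (0 : ℝ) ≤ 12 * C'))
  refine ⟨15 / 8, by norm_num, 1, max X₁ 3, fun X η hX hηlo hη1 => ?_⟩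
  have hX3 : 3 ≤ X := le_trans (le_max_right _ _) hX
  have hXX₁ : X₁ ≤ X := le_trans (le_max_left _ _) hX
  have hX0 : 0 < X := by linarith
  have hX1 : 1 ≤ X := by linarith
  have hη0 : 0 ≤ η := le_trans (Real.exp_pos _).le hηlo
  have hlog1 : 1 ≤ Real.log X := by
    rw [← Real.log_exp 1]
    exact Real.log_le_log (Real.exp_pos 1) (by linarith [Real.exp_one_lt_d9])
  have hlog0 : 0 < Real.log X := by linarith
  -- the summand
  set f : Ideal (𝓞 K) → ℝ := fun R => |(countA X η R : ℝ) - sizeA X η * rho₂ R / Ideal.absNorm R| with hf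
  have hf0 : ∀ R, 0 ≤ f R := fun R => abs_nonneg _
  -- the dyadic blocks of Lemma 3.2 with `Q = 2^j`
  set B : ℕ → Finset (Ideal (𝓞 K)) := fun j =>
    (idealsLE ⌊2 * (2 : ℝ) ^ j⌋₊).filter fun R => (2 : ℝ) ^ j < (Ideal.absNorm R : ℝ) ∧
      (Ideal.absNorm R : ℝ) ≤ 2 * (2 : ℝ) ^ j ∧ Squarefree (Ideal.absNorm R) with hB
  set n : ℕ := ⌊X ^ (3 / 2 : ℝ)⌋₊ with hn
  set J : ℕ := Nat.log 2 n + 1 with hJ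
  have hn1 : 1 ≤ n := Nat.le_floor (by rw [Nat.cast_one]; exact Real.one_le_rpow hX1 (by norm_num))
  have hnX : (n : ℝ) ≤ X ^ (3 / 2 : ℝ) := Nat.floor_le (Real.rpow_nonneg hX0.le _)
  -- the cover
  have hcover : (idealsLE n).filter (fun R => Squarefree (Ideal.absNorm R)) ⊆
      {⊤} ∪ (range J).biUnion B := by
    intro R hR
    rw [mem_filter, mem_idealsLE] at hR
    obtain ⟨hRn, hRsq⟩ := hR
    rw [mem_union, mem_singleton, mem_biUnion]
    by_cases h1 : Ideal.absNorm R = 1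
    · exact Or.inl (Ideal.absNorm_eq_one_iff.mp h1)
    · right
      have hN0 : Ideal.absNorm R ≠ 0 := hRsq.ne_zero
      have hN2 : 2 ≤ Ideal.absNorm R := by omega
      refine ⟨dyadIdx (Ideal.absNorm R), ?_, ?_⟩
      · rw [mem_range, hJ, Nat.lt_succ_iff, dyadIdx]
        exact Nat.log_mono_right (by omega)
      · have hlt := pow_dyadIdx_lt hN2
        have hle := le_pow_dyadIdx_succ (Ideal.absNorm R)
        have hlt' : (2 : ℝ) ^ dyadIdx (Ideal.absNorm R) < (Ideal.absNorm R : ℝ) := by exact_mod_cast hlt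
        have hle' : (Ideal.absNorm R : ℝ) ≤ 2 * (2 : ℝ) ^ dyadIdx (Ideal.absNorm R) := by
          rw [← pow_succ']; exact_mod_cast hle
        rw [hB, mem_filter, mem_idealsLE]
        refine ⟨?_, hlt', hle', hRsq⟩
        refine Nat.le_floor ?_
        exact hle'
  -- the block bounds from Lemma 3.2
  have hblock : ∀ j ∈ range J, ∑ R ∈ B j, f R ≤ C' * (3 * X ^ (7 / 4 : ℝ)) * ((5 / 2) * Real.log X) ^ c' := by
    intro j hj
    have hQ1 : (1 : ℝ) ≤ (2 : ℝ) ^ j := one_le_pow₀ (by norm_num)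
    have hj' : j ≤ Nat.log 2 n := by rw [mem_range, hJ, Nat.lt_succ_iff] at hj; exact hj
    have h2j : (2 : ℝ) ^ j ≤ X ^ (3 / 2 : ℝ) := by
      have h1 : 2 ^ j ≤ 2 ^ Nat.log 2 n := Nat.pow_le_pow_right (by norm_num) hj'
      have h2 : 2 ^ Nat.log 2 n ≤ n := Nat.pow_log_le_self 2 (by omega)
      calc (2 : ℝ) ^ j = ((2 ^ j : ℕ) : ℝ) := by push_cast; ring
        _ ≤ n := by exact_mod_cast h1.trans h2
        _ ≤ X ^ (3 / 2 : ℝ) := hnX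
    have hstep := hC X η ((2 : ℝ) ^ j) (by linarith) hηlo hη1 hQ1
    -- drop `τ(R) ≥ 1` and identify the block
    have hle1 : ∑ R ∈ B j, f R ≤ ∑ R ∈ B j, (idealDivisorCount R : ℝ) ^ (1 : ℕ) *
        |(countA X η R : ℝ) - 6 * η ^ 2 * X ^ 2 / Real.pi ^ 2 * rho₂ R / Ideal.absNorm R| := by
      refine sum_le_sum fun R _ => ?_
      have hτ : (1 : ℝ) ≤ (idealDivisorCount R : ℝ) ^ (1 : ℕ) := by
        rw [pow_one]; exact_mod_cast one_le_idealDivisorCount'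
      have : f R = |(countA X η R : ℝ) - 6 * η ^ 2 * X ^ 2 / Real.pi ^ 2 * rho₂ R / Ideal.absNorm R| := by
        simp only [hf, sizeA]
      rw [this]
      exact le_mul_of_one_le_left (abs_nonneg _) hτ
    refine hle1.trans (hstep.trans ?_)
    -- `C (Q + X√Q + X^{3/2}) (log QX)^c ≤ C' · 3X^{7/4} ((5/2) log X)^{c'}`
    have hX74 : X ^ (3 / 2 : ℝ) ≤ X ^ (7 / 4 : ℝ) := Real.rpow_le_rpow_of_exponent_le hX1 (by norm_num)
    have hsqrt : Real.sqrt ((2 : ℝ) ^ j) ≤ X ^ (3 / 4 : ℝ) := by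
      have hsq : X ^ (3 / 2 : ℝ) = (X ^ (3 / 4 : ℝ)) ^ 2 := by
        rw [← Real.rpow_natCast, ← Real.rpow_mul hX0.le]; norm_num
      calc Real.sqrt ((2 : ℝ) ^ j) ≤ Real.sqrt (X ^ (3 / 2 : ℝ)) := Real.sqrt_le_sqrt h2j
        _ = X ^ (3 / 4 : ℝ) := by rw [hsq, Real.sqrt_sq (Real.rpow_nonneg hX0.le _)]
    have hmid : X * Real.sqrt ((2 : ℝ) ^ j) ≤ X ^ (7 / 4 : ℝ) := by
      calc X * Real.sqrt ((2 : ℝ) ^ j) ≤ X * X ^ (3 / 4 : ℝ) := mul_le_mul_of_nonneg_left hsqrt hX0.le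
        _ = X ^ (7 / 4 : ℝ) := by rw [← Real.rpow_one_add' hX0.le (by norm_num)]; norm_num
    have hsum3 : (2 : ℝ) ^ j + X * Real.sqrt ((2 : ℝ) ^ j) + X ^ (3 / 2 : ℝ) ≤ 3 * X ^ (7 / 4 : ℝ) := by
      linarith [h2j.trans hX74]
    have hlogQX : Real.log X ≤ Real.log ((2 : ℝ) ^ j * X) ∧ Real.log ((2 : ℝ) ^ j * X) ≤ (5 / 2) * Real.log X := by
      constructor
      · exact Real.log_le_log hX0 (le_mul_of_one_le_left hX0.le hQ1)
      · calc Real.log ((2 : ℝ) ^ j * X) ≤ Real.log (X ^ (3 / 2 : ℝ) * X) :=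
              Real.log_le_log (by positivity) (mul_le_mul_of_nonneg_right h2j hX0.le)
          _ = (5 / 2) * Real.log X := by
              rw [Real.log_mul (by positivity) hX0.ne', Real.log_rpow hX0]; ring
    have hlogpow : Real.log ((2 : ℝ) ^ j * X) ^ c ≤ ((5 / 2) * Real.log X) ^ c' := by
      have hb1 : 1 ≤ Real.log ((2 : ℝ) ^ j * X) := hlog1.trans hlogQX.1
      calc Real.log ((2 : ℝ) ^ j * X) ^ c ≤ Real.log ((2 : ℝ) ^ j * X) ^ c' :=
            Real.rpow_le_rpow_of_exponent_le hb1 (le_max_left _ _)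
        _ ≤ ((5 / 2) * Real.log X) ^ c' := Real.rpow_le_rpow (by linarith) hlogQX.2 hc'0
    have hCC' : C ≤ C' := le_max_left _ _
    have hfac0 : 0 ≤ ((2 : ℝ) ^ j + X * Real.sqrt ((2 : ℝ) ^ j) + X ^ (3 / 2 : ℝ)) *
        Real.log ((2 : ℝ) ^ j * X) ^ c := by
      have : 0 ≤ Real.log ((2 : ℝ) ^ j * X) ^ c := Real.rpow_nonneg (by linarith [hlogQX.1]) _
      positivity
    calc C * ((2 : ℝ) ^ j + X * Real.sqrt ((2 : ℝ) ^ j) + X ^ (3 / 2 : ℝ)) * Real.log ((2 : ℝ) ^ j * X) ^ c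
        = C * (((2 : ℝ) ^ j + X * Real.sqrt ((2 : ℝ) ^ j) + X ^ (3 / 2 : ℝ)) * Real.log ((2 : ℝ) ^ j * X) ^ c) := by ring
      _ ≤ C' * (((2 : ℝ) ^ j + X * Real.sqrt ((2 : ℝ) ^ j) + X ^ (3 / 2 : ℝ)) * Real.log ((2 : ℝ) ^ j * X) ^ c) :=
          mul_le_mul_of_nonneg_right hCC' hfac0
      _ ≤ C' * ((3 * X ^ (7 / 4 : ℝ)) * ((5 / 2) * Real.log X) ^ c') := by
          refine mul_le_mul_of_nonneg_left ?_ hC'0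
          exact mul_le_mul hsum3 hlogpow (Real.rpow_nonneg (by linarith [hlogQX.1]) _) (by positivity)
      _ = C' * (3 * X ^ (7 / 4 : ℝ)) * ((5 / 2) * Real.log X) ^ c' := by ring
  -- the number of blocks: `J ≤ 4 log X`
  have hJle : (J : ℝ) ≤ 4 * Real.log X := by
    have h2 : 2 ^ Nat.log 2 n ≤ n := Nat.pow_log_le_self 2 (by omega)
    have h3 : (2 : ℝ) ^ Nat.log 2 n ≤ X ^ (3 / 2 : ℝ) := by
      calc (2 : ℝ) ^ Nat.log 2 n = ((2 ^ Nat.log 2 n : ℕ) : ℝ) := by push_cast; ring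
        _ ≤ n := by exact_mod_cast h2
        _ ≤ X ^ (3 / 2 : ℝ) := hnX
    have h4 : (Nat.log 2 n : ℝ) * Real.log 2 ≤ (3 / 2) * Real.log X := by
      rw [← Real.log_pow, ← Real.log_rpow hX0]
      exact Real.log_le_log (by positivity) h3
    have hlog2 : (1 / 2 : ℝ) < Real.log 2 := by linarith [Real.log_two_gt_d9]
    have h5 : (Nat.log 2 n : ℝ) ≤ 3 * Real.log X := by
      by_contra hcon
      push Not at hcon
      nlinarith
    rw [hJ]; push_cast; linarith
  -- assemble
  have htop : f ⊤ ≤ C₁ * X * (1 + Real.log X) := by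
    have h := hC₁ X η (by linarith) hη0 hη1
    simp only [hf]
    rw [show (⊤ : Ideal (𝓞 K)) = 1 from Ideal.one_eq_top.symm, rho₂, primeFactorsFinset]
    have hpf : ((idealsLE (Ideal.absNorm (1 : Ideal (𝓞 K)))).filter
        fun P : Ideal (𝓞 K) => P.IsPrime ∧ P ∣ 1) = ∅ := by
      rw [filter_eq_empty_iff]
      rintro P - ⟨hP, hP1⟩
      exact hP.ne_top (Ideal.isUnit_iff.mp (isUnit_of_dvd_one hP1))
    rw [hpf, prod_empty, Ideal.one_eq_top, Ideal.absNorm_top, Nat.cast_one, div_one, mul_one]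
    rw [Ideal.one_eq_top] at h
    exact h
  calc ∑ R ∈ (idealsLE n).filter (fun R => Squarefree (Ideal.absNorm R)), f R
      ≤ ∑ R ∈ {⊤} ∪ (range J).biUnion B, f R := sum_le_sum_of_subset_of_nonneg hcover fun R _ _ => hf0 R
    _ ≤ ∑ R ∈ ({⊤} : Finset (Ideal (𝓞 K))), f R + ∑ R ∈ (range J).biUnion B, f R := sum_union_le_add _ _ hf0
    _ ≤ f ⊤ + ∑ j ∈ range J, ∑ R ∈ B j, f R := by
        rw [sum_singleton]
        linarith [sum_biUnion_le_sum_sum_of_nonneg (range J) B hf0]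
    _ ≤ C₁ * X * (1 + Real.log X) + ∑ _j ∈ range J, C' * (3 * X ^ (7 / 4 : ℝ)) * ((5 / 2) * Real.log X) ^ c' :=
        add_le_add htop (sum_le_sum hblock)
    _ = C₁ * X * (1 + Real.log X) + J * (C' * (3 * X ^ (7 / 4 : ℝ)) * ((5 / 2) * Real.log X) ^ c') := by
        rw [sum_const, card_range, nsmul_eq_mul]
    _ ≤ C₁ * X * (1 + Real.log X) + 4 * Real.log X * (C' * (3 * X ^ (7 / 4 : ℝ)) * ((5 / 2) * Real.log X) ^ c') := by
        have : 0 ≤ C' * (3 * X ^ (7 / 4 : ℝ)) * ((5 / 2) * Real.log X) ^ c' := by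
          have : 0 ≤ ((5 / 2) * Real.log X) ^ c' := Real.rpow_nonneg (by positivity) _
          positivity
        nlinarith
    _ = C₁ * X * (1 + Real.log X) + 12 * C' * Real.log X * X ^ (7 / 4 : ℝ) * ((5 / 2) * Real.log X) ^ c' := by ring
    _ ≤ X ^ (15 / 8 : ℝ) := hX₁ X hXX₁
    _ = 1 * X ^ (15 / 8 : ℝ) := (one_mul _).symm

end Literature.NumberTheory.Sieve.CubicSieve

end
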